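import Literature.AlgebraicGeometry.HodgeTheory.BettiTranscendentalPartMinimalityHodgeLevelProducts
import Literature.AlgebraicGeometry.HodgeTheory.BettiHodgeConjectureProductsHodgeDisjointWindow
import HarnessLib

/-!
# The numerical LEVEL criterion: `HC(Y × Z)` from `HC(Y)`, `HC(Z)` and the vanishing of the products `h^{r+1+k, r−k}(Y) · h^{t+1+k, t−k}(Z)` (`k ≥ 0`; top odd degrees `2r+1`, `2t+1`) and
# `h^{μ+k, μ−k}(Y) · h^{ν+k, ν−k}(Z)` (`k ≥ 1`; top even degrees `2μ`, `2ν`) — the TOP degrees only; every surface, threefold × fourfold, fourfold × `Z`, two fourfolds, numerically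
# (Voisin I §7.1.1, §7.3.1 Def. 7.22, §11.3.3 Thm. 11.38–11.40, Lemma 11.41, pp. 285–287, Thm. 11.30; Huybrechts K3 Ch. 3 Def. 2.5; Voisin II Prop. 9.20; Deligne Hodge II 1.2.5, 2.1.13)

Family `hodge`, lane `lit-hodgefound` (Track 2 foundations library; Layers A1/A2/A4), layer `Literature/AlgebraicGeometry/HodgeTheory`.  THEOREMS ONLY (no definition, no named fact,
no instance, no notation; D-0026 net debt `0`).  Prover seat `lit-hodgefound-p21` (generation 40, row g40-#7), sequel of g40-#5/#6 (`BettiTranscendentalPartMinimalityHodgeLevelProducts`: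
`HC(Y × Z)` ⟸ `HC(Y)`, `HC(Z)`, `Hom_HS(H^{mₒ}(Y), H^{nₒ}(Z)(s)) = 0` and the even LEVEL products `h^{μ+k,μ−k}(Y) · h^{ν+k,ν−k}(Z) = 0`).  Here the remaining `Hom` condition on the top ODD degrees is
made numerical too, by the tree's Hodge-disjointness lemma `hodgeHom_toLinearMap_eq_zero_of_forall_piece_eq_bot_or` (p29 g31) and Hodge symmetry, so that **the whole criterion reads off the
Hodge diamonds of the two factors in their four top degrees**.

THE MATHEMATICS.  Let `Y`, `Z` be smooth projective of dimensions `m, n ≥ 1`, with top odd degrees `mₒ = 2r + 1` (`2r+1 ≤ m ≤ 2r+2`), `nₒ = 2t + 1`, and top even degrees `2μ`, `2ν`.  A morphism of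
Hodge structures `H^{2r+1}(Y) → H^{2t+1}(Z)(t − r)` maps `H^{p, 2r+1−p}(Y)` into `H^{p+t−r, t+r+1−p}(Z)`; if for every `p` one of the two pieces vanishes the morphism is `0` (the pieces span, Voisin
§7.1.1; the tree's `hodgeHom_toLinearMap_eq_zero_of_forall_piece_eq_bot_or`).  By Hodge symmetry it suffices to test the upper halves `p = r + 1 + k`, `k ≥ 0`: **`Hom_HS(H^{2r+1}(Y), H^{2t+1}(Z)(t−r)) = 0`
as soon as `h^{r+1+k, r−k}(Y) · h^{t+1+k, t−k}(Z) = 0` for `0 ≤ k ≤ min(r, t)`** (§1).  With g40-#5 (§3 there: the even condition from `h^{μ+k,μ−k}(Y) · h^{ν+k,ν−k}(Z) = 0`, `1 ≤ k ≤ min(μ,ν)`, by the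
MINIMALITY of the transcendental part) this gives the **numerical level criterion** (§2): **`HC(Y × Z)` ⟸ `HC(Y)`, `HC(Z)`, `h^{r+1+k, r−k}(Y) · h^{t+1+k, t−k}(Z) = 0` (`0 ≤ k ≤ min(r,t)`) and
`h^{μ+k, μ−k}(Y) · h^{ν+k, ν−k}(Z) = 0` (`1 ≤ k ≤ min(μ,ν)`).**  Compared with the tree's numerical WINDOW criterion (`BettiUniverse.hodgeConjectureFor_tensor_of_forall_reducedWindow_hodgeNumber_mul_eq_zero`,
p29 g33: products over ALL reduced-window degree pairs `(i, j)`), only the four TOP degrees enter, and in the even degrees the `(μ,μ) × (ν,ν)` products — never zero — are not asked (the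
transcendental parts take care of them); by hard Lefschetz the top degrees dominate the lower ones, so nothing is lost.  Instances (§3): **every surface `S`: `HC(S × Z)` ⟸ `HC(Z)`,
`q(S) · h^{t+1,t}(Z) = 0`, `p_g(S) · h^{ν+1,ν−1}(Z) = 0`**; `S ×` fourfold ⟸ `HC(F)`, `q(S) · h^{2,1}(F) = 0`, `p_g(S) · h^{3,1}(F) = 0`; threefold × fourfold ⟸ `HC(F)`, `h^{2,1}(T) h^{2,1}(F) = 0`,
`h^{3,0}(T) h^{3,0}(F) = 0`, `h^{2,0}(T) h^{3,1}(F) = 0`; **fourfold × `Z`**; **two fourfolds ⟸ `HC(F)`, `HC(F')`, `h^{2,1}h'^{2,1} = 0`, `h^{3,0}h'^{3,0} = 0`, `h^{3,1}h'^{3,1} = 0`, `h^{4,0}h'^{4,0} = 0`**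
(the tree's `…tensor_fourfolds_of_hodgeNumber_mul_eq_zero` needs in addition `p_g(F) = 0 ∨ Hdg²(H⁴F') = H⁴(F')` and its mirror).

THE PRINTS.  C. Voisin (2002) [VoisinHodgeI2002] §7.1.1 (Hodge decomposition, Hodge symmetry `h^{p,q} = h^{q,p}`), §7.3.1 Def. 7.22 (morphisms of bidegree `(0,0)`), §6.1.3 Cor. 6.13, §11.3.1 Thm. 11.30,
§11.3.3 Thm. 11.38–11.40, Lemma 11.41, pp. 285–287.  D. Huybrechts (2016) [Huybrechts2016K3] Ch. 3 Def. 2.5, Lemma 3.1.  C. Voisin (2003) [VoisinHodgeII2003] §9.2.4 Prop. 9.20.  P. Deligne (1971)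
[DeligneHodgeII1971] 1.2.5, 2.1.13; (2000) [Deligne2000] §1.

THE OBJECTS (all the tree's).  `Hⁱ(X) = BettiUniverse.hodge hHD hX i`, `hodgeNumber`, `piece`, `tateTwist`, `cast`, `cast_piece`, `piece_tateTwist`, `hodgeNumber_symm_holds`,
`hodgeHom_toLinearMap_eq_zero_of_forall_piece_eq_bot_or`, `BettiUniverse.piece_hodge_eq_bot_of_lt_left/right`, `BettiUniverse.piece_hodge_eq_bot_iff_hodgeNumber_eq_zero`, g40-#5's
`BettiUniverse.hodgeConjectureFor_tensor_of_subsingleton_hom_odd_of_forall_hodgeNumber_mul_eq_zero`, `hodgeConjectureFor_of_dim_le_three_holds`.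

WHAT IS PROVED.
* §1 **`BettiUniverse.subsingleton_hom_hodge_odd_twist_of_forall_hodgeNumber_mul_eq_zero`** (`Hom_HS(H^{2r+1}(Y), H^{2t+1}(Z)(t−r)) = 0` from `h^{r+1+k,r−k}(Y) · h^{t+1+k,t−k}(Z) = 0`, `0 ≤ k ≤ min(r,t)`).
* §2 **`BettiUniverse.hodgeConjectureFor_tensor_of_forall_hodgeNumber_mul_eq_zero`** (the numerical level criterion, all dimensions).
* §3 **`BettiUniverse.hodgeConjectureFor_surface_tensor_of_hodgeNumber_mul_eq_zero`** (every surface × `Z`), `…surface_tensor_fourfold_of_hodgeNumber_mul_eq_zero`,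
  `…threefold_tensor_fourfold_of_hodgeNumber_mul_eq_zero'` (three products), **`…fourfold_tensor_of_forall_hodgeNumber_mul_eq_zero`** (fourfold × `Z`),
  **`…tensor_fourfolds_of_hodgeNumber_mul_eq_zero'`** (four products).

## References
* [VoisinHodgeI2002] C. Voisin, *Hodge Theory and Complex Algebraic Geometry I* (2002) — §6.1.3 Cor. 6.13; §7.1.1; §7.3.1 Def. 7.22; §11.3.1 Thm. 11.30; §11.3.3 Thm. 11.38–11.40, Lemma 11.41, pp. 285–287.
* [Huybrechts2016K3] D. Huybrechts, *Lectures on K3 Surfaces* (2016) — Ch. 3 Def. 2.5, Lemma 3.1.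
* [VoisinHodgeII2003] C. Voisin, *Hodge Theory and Complex Algebraic Geometry II* (2003) — §9.2.4 Prop. 9.20.
* [DeligneHodgeII1971] P. Deligne, *Théorie de Hodge II* (1971) — 1.2.5, 2.1.13.
* [Deligne2000] P. Deligne, *The Hodge conjecture* (Clay, 2000) — §1.

## Provenance
Lane `lit-hodgefound` (Hodge path, Track 2), prover seat `lit-hodgefound-p21` (generation 40), self-proposed row g40-#7 (sequel of g40-#5/#6; uses p29's g31 `BettiHodgeConjectureProductsHodgeDisjointWindow`
(`hodgeHom_toLinearMap_eq_zero_of_forall_piece_eq_bot_or`)).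
-/

noncomputable section

open scoped TensorProduct
open CategoryTheory MonoidalCategory Module Finset
open Literature.AlgebraicTopology.SingularHomology
open Literature.Geometry.Kaehler

namespace Literature.AlgebraicGeometry.HodgeTheory

open Literature.AlgebraicGeometry.Motives
open Literature.AlgebraicGeometry.Motives.HodgeStructure

variable {m n d : ℕ} {Y Z S T F F' : SchemeOver ℂ}

/-! ### §1 `Hom_HS(H^{2r+1}(Y), H^{2t+1}(Z)(t − r)) = 0` from the half-level products `h^{r+1+k, r−k}(Y) · h^{t+1+k, t−k}(Z) = 0` -/

section Odd

/-- **`Hom_HS(H^{2r+1}(Y), H^{2t+1}(Z)(s)) = 0` (`2t + 1 − 2s = 2r + 1`) as soon as `h^{r+1+k, r−k}(Y) · h^{t+1+k, t−k}(Z) = 0` for every `0 ≤ k ≤ min(r, t)`**: a morphism maps `H^{p,2r+1−p}(Y)` into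
`H^{p+s, 2r+1−p+s}(Z)`, one of which vanishes for every `p` — for `p ≥ r + 1` by the hypothesis at `k = p − r − 1`, for `p ≤ r` by the hypothesis at `k = r − p` and Hodge symmetry, and outside
`0 ≤ p ≤ 2r+1` / `|k| > t` because cohomology of degree `j` has no `(a,b)`-part with `a > j` or `b > j` — so the morphism is `0` (Hodge-disjointness; the pieces span).
[cite: VoisinHodgeI2002, §7.1.1, §7.3.1 Def. 7.22 and §6.1.3 Cor. 6.13] [cite: DeligneHodgeII1971, 1.2.5 and 2.1.13] -/
theorem BettiUniverse.subsingleton_hom_hodge_odd_twist_of_forall_hodgeNumber_mul_eq_zero (hHD : exists_isReal_hodgeModel) (hY : IsSmoothProjective m Y) (hZ : IsSmoothProjective n Z) (r t : ℕ)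
    {s : ℤ} (hs : ((2 * t + 1 : ℕ) : ℤ) - 2 * s = ((2 * r + 1 : ℕ) : ℤ))
    (h : ∀ k : ℕ, k ≤ r → k ≤ t →
      (BettiUniverse.hodge hHD hY (2 * r + 1)).hodgeNumber ((r : ℤ) + 1 + k) ((r : ℤ) - k) * (BettiUniverse.hodge hHD hZ (2 * t + 1)).hodgeNumber ((t : ℤ) + 1 + k) ((t : ℤ) - k) = 0) :
    Subsingleton (Hom (BettiUniverse.hodge hHD hY (2 * r + 1)) (((BettiUniverse.hodge hHD hZ (2 * t + 1)).tateTwist s).cast hs)) := by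
  have hs₀ : s = (t : ℤ) - r := by push_cast at hs; omega
  refine subsingleton_of_forall_eq 0 fun f ↦ Hom.ext ?_
  rw [Hom.zero_toLinearMap]
  refine hodgeHom_toLinearMap_eq_zero_of_forall_piece_eq_bot_or f fun p ↦ ?_
  rw [cast_piece, piece_tateTwist]
  -- outside `0 ≤ p ≤ 2r + 1` the `Y`-piece vanishes
  by_cases hp0 : p < 0
  · exact Or.inl (BettiUniverse.piece_hodge_eq_bot_of_lt_right hHD hY (2 * r + 1) _ (by push_cast; omega))
  by_cases hp1 : ((2 * r + 1 : ℕ) : ℤ) < p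
  · exact Or.inl (BettiUniverse.piece_hodge_eq_bot_of_lt_left hHD hY (2 * r + 1) _ hp1)
  push_cast at hp1
  by_cases hpr : (r : ℤ) + 1 ≤ p
  · -- upper half: `p = r + 1 + k`
    obtain ⟨k, hk⟩ : ∃ k : ℕ, (k : ℤ) = p - r - 1 := ⟨(p - r - 1).toNat, Int.toNat_of_nonneg (by omega)⟩
    by_cases hkt : t < k
    · exact Or.inr (BettiUniverse.piece_hodge_eq_bot_of_lt_left hHD hZ (2 * t + 1) _ (by push_cast; omega))
    rcases mul_eq_zero.1 (h k (by omega) (not_lt.1 hkt)) with h0 | h0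
    · left
      rw [← BettiUniverse.piece_hodge_eq_bot_iff_hodgeNumber_eq_zero] at h0
      have e1 : (r : ℤ) + 1 + k = p := by omega
      have e2 : (r : ℤ) - k = ((2 * r + 1 : ℕ) : ℤ) - p := by push_cast; omega
      rwa [e1, e2] at h0
    · right
      rw [← BettiUniverse.piece_hodge_eq_bot_iff_hodgeNumber_eq_zero] at h0
      have e1 : (t : ℤ) + 1 + k = p + s := by omega
      have e2 : (t : ℤ) - k = ((2 * r + 1 : ℕ) : ℤ) - p + s := by push_cast; omega
      rwa [e1, e2] at h0
  · -- lower half: `p = r - k`, use Hodge symmetry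
    obtain ⟨k, hk⟩ : ∃ k : ℕ, (k : ℤ) = r - p := ⟨((r : ℤ) - p).toNat, Int.toNat_of_nonneg (by omega)⟩
    by_cases hkt : t < k
    · exact Or.inr (BettiUniverse.piece_hodge_eq_bot_of_lt_right hHD hZ (2 * t + 1) _ (by push_cast; omega))
    rcases mul_eq_zero.1 (h k (by omega) (not_lt.1 hkt)) with h0 | h0
    · left
      rw [hodgeNumber_symm_holds (BettiUniverse.hodge hHD hY (2 * r + 1)) ((r : ℤ) + 1 + k) ((r : ℤ) - k), ← BettiUniverse.piece_hodge_eq_bot_iff_hodgeNumber_eq_zero] at h0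
      have e1 : (r : ℤ) - k = p := by omega
      have e2 : (r : ℤ) + 1 + k = ((2 * r + 1 : ℕ) : ℤ) - p := by push_cast; omega
      rwa [e1, e2] at h0
    · right
      rw [hodgeNumber_symm_holds (BettiUniverse.hodge hHD hZ (2 * t + 1)) ((t : ℤ) + 1 + k) ((t : ℤ) - k), ← BettiUniverse.piece_hodge_eq_bot_iff_hodgeNumber_eq_zero] at h0
      have e1 : (t : ℤ) - k = p + s := by omega
      have e2 : (t : ℤ) + 1 + k = ((2 * r + 1 : ℕ) : ℤ) - p + s := by push_cast; omega
      rwa [e1, e2] at h0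

end Odd

/-! ### §2 The numerical level criterion, all dimensions -/

section Criterion

/-- **THE NUMERICAL LEVEL CRITERION.**  `Y`, `Z` smooth projective of dimensions `m, n ≥ 1` with `HC(Y)`, `HC(Z)`; `2r+1`, `2t+1` their top odd degrees (`2r+1 ≤ m ≤ 2r+2`, `2t+1 ≤ n ≤ 2t+2`) and
`2μ`, `2ν` their top even degrees (`2μ ≤ m ≤ 2μ+1`, `2ν ≤ n ≤ 2ν+1`).  If **`h^{r+1+k, r−k}(Y) · h^{t+1+k, t−k}(Z) = 0` for `0 ≤ k ≤ min(r, t)`** and **`h^{μ+k, μ−k}(Y) · h^{ν+k, ν−k}(Z) = 0` for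
`1 ≤ k ≤ min(μ, ν)`**, then `HC(Y × Z)` — g40-#5's criterion with its odd `Hom` condition discharged by §1. [cite: VoisinHodgeI2002, §7.1.1, §11.3.3 Thm. 11.38–11.40, Lemma 11.41, pp. 285–287]
[cite: Huybrechts2016K3, Ch. 3 Def. 2.5 and Lemma 3.1] [cite: VoisinHodgeII2003, §9.2.4 Prop. 9.20] [cite: DeligneHodgeII1971, 1.2.5 and 2.1.13] [cite: Deligne2000, §1] -/
theorem BettiUniverse.hodgeConjectureFor_tensor_of_forall_hodgeNumber_mul_eq_zero (hHD : exists_isReal_hodgeModel) (hY : IsSmoothProjective m Y) (hZ : IsSmoothProjective n Z)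
    (hYZ : IsSmoothProjective d (Y ⊗ Z)) (hHCY : HodgeConjectureFor m Y) (hHCZ : HodgeConjectureFor n Z) {r t : ℕ} (hr : 2 * r + 1 ≤ m) (hmr : m ≤ 2 * r + 2) (ht : 2 * t + 1 ≤ n)
    (hnt : n ≤ 2 * t + 2)
    (hodd : ∀ k : ℕ, k ≤ r → k ≤ t →
      (BettiUniverse.hodge hHD hY (2 * r + 1)).hodgeNumber ((r : ℤ) + 1 + k) ((r : ℤ) - k) * (BettiUniverse.hodge hHD hZ (2 * t + 1)).hodgeNumber ((t : ℤ) + 1 + k) ((t : ℤ) - k) = 0)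
    {μ ν : ℕ} (hμ : 2 * μ ≤ m) (hmμ : m ≤ 2 * μ + 1) (hν : 2 * ν ≤ n) (hnν : n ≤ 2 * ν + 1)
    (heven : ∀ k : ℕ, 1 ≤ k → k ≤ μ → k ≤ ν →
      (BettiUniverse.hodge hHD hY (2 * μ)).hodgeNumber ((μ : ℤ) + k) ((μ : ℤ) - k) * (BettiUniverse.hodge hHD hZ (2 * ν)).hodgeNumber ((ν : ℤ) + k) ((ν : ℤ) - k) = 0) :
    HodgeConjectureFor d (Y ⊗ Z) :=
  BettiUniverse.hodgeConjectureFor_tensor_of_subsingleton_hom_odd_of_forall_hodgeNumber_mul_eq_zero hHD hY hZ hYZ hHCY hHCZ (mₒ := 2 * r + 1) ⟨r, rfl⟩ hr hmr (nₒ := 2 * t + 1) ⟨t, rfl⟩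
    ht hnt (s := (t : ℤ) - r) (by push_cast; ring) (BettiUniverse.subsingleton_hom_hodge_odd_twist_of_forall_hodgeNumber_mul_eq_zero hHD hY hZ r t _ hodd) hμ hmμ hν hnν heven

end Criterion

/-! ### §3 Instances: every surface; surface × fourfold; threefold × fourfold; fourfold × `Z`; two fourfolds -/

section Instances

/-- **EVERY SURFACE, NUMERICALLY: `HC(S × Z)` ⟸ `HC(Z)`, `q(S) · h^{t+1, t}(Z) = 0` and `p_g(S) · h^{ν+1, ν−1}(Z) = 0`** (`2t+1`, `2ν` the top odd and even degrees of `Z`, `dim Z ≥ 1`; `HC(S)` by Lefschetz).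
[cite: VoisinHodgeI2002, §7.1.1, §11.3.1 Thm. 11.30, §11.3.3 Lemma 11.41, pp. 285–287] [cite: Huybrechts2016K3, Ch. 3 Def. 2.5 and Lemma 3.1] [cite: VoisinHodgeII2003, §9.2.4 Prop. 9.20] [cite: Deligne2000, §1] -/
theorem BettiUniverse.hodgeConjectureFor_surface_tensor_of_hodgeNumber_mul_eq_zero (hHD : exists_isReal_hodgeModel) (hS : IsSmoothProjective 2 S) (hZ : IsSmoothProjective n Z)
    (hSZ : IsSmoothProjective d (S ⊗ Z)) (hHCZ : HodgeConjectureFor n Z) {t : ℕ} (ht : 2 * t + 1 ≤ n) (hnt : n ≤ 2 * t + 2) {ν : ℕ} (hν : 2 * ν ≤ n) (hnν : n ≤ 2 * ν + 1)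
    (hq : (BettiUniverse.hodge hHD hS 1).hodgeNumber 1 0 * (BettiUniverse.hodge hHD hZ (2 * t + 1)).hodgeNumber ((t : ℤ) + 1) t = 0)
    (hpg : (BettiUniverse.hodge hHD hS 2).hodgeNumber 2 0 * (BettiUniverse.hodge hHD hZ (2 * ν)).hodgeNumber ((ν : ℤ) + 1) ((ν : ℤ) - 1) = 0) : HodgeConjectureFor d (S ⊗ Z) :=
  BettiUniverse.hodgeConjectureFor_tensor_of_forall_hodgeNumber_mul_eq_zero hHD hS hZ hSZ (hodgeConjectureFor_of_dim_le_three_holds (by norm_num) hS) hHCZ (r := 0) (by norm_num) (by norm_num)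
    ht hnt
    (fun k hk _ ↦ by
      obtain rfl : k = 0 := Nat.le_zero.1 hk
      rw [show ((0 : ℕ) : ℤ) + 1 + ((0 : ℕ) : ℤ) = 1 by norm_num, show ((0 : ℕ) : ℤ) - ((0 : ℕ) : ℤ) = 0 by norm_num, show (t : ℤ) + 1 + ((0 : ℕ) : ℤ) = t + 1 by norm_num,
        show (t : ℤ) - ((0 : ℕ) : ℤ) = t by norm_num]
      exact hq)
    (μ := 1) (by norm_num) (by norm_num) hν hnν fun k hk1 hkμ _ ↦ by
      obtain rfl : k = 1 := le_antisymm hkμ hk1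
      rw [show ((1 : ℕ) : ℤ) + ((1 : ℕ) : ℤ) = 2 by norm_num, show ((1 : ℕ) : ℤ) - ((1 : ℕ) : ℤ) = 0 by norm_num, show (ν : ℤ) + ((1 : ℕ) : ℤ) = ν + 1 by norm_num,
        show (ν : ℤ) - ((1 : ℕ) : ℤ) = ν - 1 by norm_num]
      exact hpg

/-- **A surface times a fourfold, numerically: `HC(S × F)` ⟸ `HC(F)`, `q(S) · h^{2,1}(F) = 0`, `p_g(S) · h^{3,1}(F) = 0`.** [cite: VoisinHodgeI2002, §7.1.1, §11.3.1 Thm. 11.30, §11.3.3 Lemma 11.41, pp. 285–287]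
[cite: Huybrechts2016K3, Ch. 3 Def. 2.5 and Lemma 3.1] [cite: VoisinHodgeII2003, §9.2.4 Prop. 9.20] -/
theorem BettiUniverse.hodgeConjectureFor_surface_tensor_fourfold_of_hodgeNumber_mul_eq_zero (hHD : exists_isReal_hodgeModel) (hS : IsSmoothProjective 2 S) (hF : IsSmoothProjective 4 F)
    (hSF : IsSmoothProjective d (S ⊗ F)) (hHCF : HodgeConjectureFor 4 F) (hq : (BettiUniverse.hodge hHD hS 1).hodgeNumber 1 0 * (BettiUniverse.hodge hHD hF 3).hodgeNumber 2 1 = 0)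
    (hpg : (BettiUniverse.hodge hHD hS 2).hodgeNumber 2 0 * (BettiUniverse.hodge hHD hF 4).hodgeNumber 3 1 = 0) : HodgeConjectureFor d (S ⊗ F) :=
  BettiUniverse.hodgeConjectureFor_surface_tensor_of_hodgeNumber_mul_eq_zero hHD hS hF hSF hHCF (t := 1) (by norm_num) (by norm_num) (ν := 2) (by norm_num) (by norm_num)
    (by rw [show ((1 : ℕ) : ℤ) + 1 = 2 by norm_num]; exact hq) (by rw [show ((2 : ℕ) : ℤ) + 1 = 3 by norm_num, show ((2 : ℕ) : ℤ) - 1 = 1 by norm_num]; exact hpg)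

/-- **A threefold times a fourfold, numerically: `HC(T × F)` ⟸ `HC(F)`, `h^{2,1}(T) · h^{2,1}(F) = 0`, `h^{3,0}(T) · h^{3,0}(F) = 0`, `h^{2,0}(T) · h^{3,1}(F) = 0`** (`HC(T)` holds; three products, against
the six of the tree's `…fourfold_tensor_threefold_of_hodgeNumber_mul_eq_zero`). [cite: VoisinHodgeI2002, §7.1.1, §11.3.1 Thm. 11.30, §11.3.3 Lemma 11.41, pp. 285–287] [cite: Huybrechts2016K3, Ch. 3 Def. 2.5 and Lemma 3.1]
[cite: VoisinHodgeII2003, §9.2.4 Prop. 9.20] [cite: Deligne2000, §1] -/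
theorem BettiUniverse.hodgeConjectureFor_threefold_tensor_fourfold_of_hodgeNumber_mul_eq_zero' (hHD : exists_isReal_hodgeModel) (hT : IsSmoothProjective 3 T) (hF : IsSmoothProjective 4 F)
    (hTF : IsSmoothProjective d (T ⊗ F)) (hHCF : HodgeConjectureFor 4 F) (h21 : (BettiUniverse.hodge hHD hT 3).hodgeNumber 2 1 * (BettiUniverse.hodge hHD hF 3).hodgeNumber 2 1 = 0)
    (h30 : (BettiUniverse.hodge hHD hT 3).hodgeNumber 3 0 * (BettiUniverse.hodge hHD hF 3).hodgeNumber 3 0 = 0)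
    (h20 : (BettiUniverse.hodge hHD hT 2).hodgeNumber 2 0 * (BettiUniverse.hodge hHD hF 4).hodgeNumber 3 1 = 0) : HodgeConjectureFor d (T ⊗ F) :=
  BettiUniverse.hodgeConjectureFor_tensor_of_forall_hodgeNumber_mul_eq_zero hHD hT hF hTF (hodgeConjectureFor_of_dim_le_three_holds le_rfl hT) hHCF (r := 1) (by norm_num) (by norm_num)
    (t := 1) (by norm_num) (by norm_num)
    (fun k hk _ ↦ by
      rcases (show k = 0 ∨ k = 1 by omega) with rfl | rfl
      · rw [show ((1 : ℕ) : ℤ) + 1 + ((0 : ℕ) : ℤ) = 2 by norm_num, show ((1 : ℕ) : ℤ) - ((0 : ℕ) : ℤ) = 1 by norm_num]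
        exact h21
      · rw [show ((1 : ℕ) : ℤ) + 1 + ((1 : ℕ) : ℤ) = 3 by norm_num, show ((1 : ℕ) : ℤ) - ((1 : ℕ) : ℤ) = 0 by norm_num]
        exact h30)
    (μ := 1) (by norm_num) (by norm_num) (ν := 2) (by norm_num) (by norm_num) fun k hk1 hkμ _ ↦ by
      obtain rfl : k = 1 := le_antisymm hkμ hk1
      rw [show ((1 : ℕ) : ℤ) + ((1 : ℕ) : ℤ) = 2 by norm_num, show ((1 : ℕ) : ℤ) - ((1 : ℕ) : ℤ) = 0 by norm_num, show ((2 : ℕ) : ℤ) + ((1 : ℕ) : ℤ) = 3 by norm_num,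
        show ((2 : ℕ) : ℤ) - ((1 : ℕ) : ℤ) = 1 by norm_num]
      exact h20

/-- **A FOURFOLD TIMES `Z`, NUMERICALLY: `HC(F × Z)` ⟸ `HC(F)`, `HC(Z)`, `h^{2,1}(F) · h^{t+1,t}(Z) = 0`, [`t ≥ 1 →`] `h^{3,0}(F) · h^{t+2,t−1}(Z) = 0`, `h^{3,1}(F) · h^{ν+1,ν−1}(Z) = 0`, [`ν ≥ 2 →`]
`h^{4,0}(F) · h^{ν+2,ν−2}(Z) = 0`** (`2t+1`, `2ν` the top odd and even degrees of `Z`). [cite: VoisinHodgeI2002, §7.1.1, §11.3.3 Thm. 11.38–11.40, Lemma 11.41, pp. 285–287] [cite: Huybrechts2016K3, Ch. 3 Def. 2.5 and Lemma 3.1]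
[cite: VoisinHodgeII2003, §9.2.4 Prop. 9.20] [cite: Deligne2000, §1] -/
theorem BettiUniverse.hodgeConjectureFor_fourfold_tensor_of_forall_hodgeNumber_mul_eq_zero (hHD : exists_isReal_hodgeModel) (hF : IsSmoothProjective 4 F) (hZ : IsSmoothProjective n Z)
    (hFZ : IsSmoothProjective d (F ⊗ Z)) (hHCF : HodgeConjectureFor 4 F) (hHCZ : HodgeConjectureFor n Z) {t : ℕ} (ht : 2 * t + 1 ≤ n) (hnt : n ≤ 2 * t + 2) {ν : ℕ} (hν : 2 * ν ≤ n)
    (hnν : n ≤ 2 * ν + 1) (h21 : (BettiUniverse.hodge hHD hF 3).hodgeNumber 2 1 * (BettiUniverse.hodge hHD hZ (2 * t + 1)).hodgeNumber ((t : ℤ) + 1) t = 0)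
    (h30 : 1 ≤ t → (BettiUniverse.hodge hHD hF 3).hodgeNumber 3 0 * (BettiUniverse.hodge hHD hZ (2 * t + 1)).hodgeNumber ((t : ℤ) + 2) ((t : ℤ) - 1) = 0)
    (h31 : (BettiUniverse.hodge hHD hF 4).hodgeNumber 3 1 * (BettiUniverse.hodge hHD hZ (2 * ν)).hodgeNumber ((ν : ℤ) + 1) ((ν : ℤ) - 1) = 0)
    (h40 : 2 ≤ ν → (BettiUniverse.hodge hHD hF 4).hodgeNumber 4 0 * (BettiUniverse.hodge hHD hZ (2 * ν)).hodgeNumber ((ν : ℤ) + 2) ((ν : ℤ) - 2) = 0) : HodgeConjectureFor d (F ⊗ Z) :=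
  BettiUniverse.hodgeConjectureFor_tensor_of_forall_hodgeNumber_mul_eq_zero hHD hF hZ hFZ hHCF hHCZ (r := 1) (by norm_num) (by norm_num) ht hnt
    (fun k hk hkt ↦ by
      rcases (show k = 0 ∨ k = 1 by omega) with rfl | rfl
      · rw [show ((1 : ℕ) : ℤ) + 1 + ((0 : ℕ) : ℤ) = 2 by norm_num, show ((1 : ℕ) : ℤ) - ((0 : ℕ) : ℤ) = 1 by norm_num, show (t : ℤ) + 1 + ((0 : ℕ) : ℤ) = t + 1 by norm_num,
          show (t : ℤ) - ((0 : ℕ) : ℤ) = t by norm_num]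
        exact h21
      · rw [show ((1 : ℕ) : ℤ) + 1 + ((1 : ℕ) : ℤ) = 3 by norm_num, show ((1 : ℕ) : ℤ) - ((1 : ℕ) : ℤ) = 0 by norm_num, show (t : ℤ) + 1 + ((1 : ℕ) : ℤ) = t + 2 by push_cast; ring,
          show (t : ℤ) - ((1 : ℕ) : ℤ) = t - 1 by norm_num]
        exact h30 hkt)
    (μ := 2) (by norm_num) (by norm_num) hν hnν fun k hk1 hkμ hkν ↦ by
      rcases (show k = 1 ∨ k = 2 by omega) with rfl | rfl
      · rw [show ((2 : ℕ) : ℤ) + ((1 : ℕ) : ℤ) = 3 by norm_num, show ((2 : ℕ) : ℤ) - ((1 : ℕ) : ℤ) = 1 by norm_num, show (ν : ℤ) + ((1 : ℕ) : ℤ) = ν + 1 by norm_num,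
          show (ν : ℤ) - ((1 : ℕ) : ℤ) = ν - 1 by norm_num]
        exact h31
      · rw [show ((2 : ℕ) : ℤ) + ((2 : ℕ) : ℤ) = 4 by norm_num, show ((2 : ℕ) : ℤ) - ((2 : ℕ) : ℤ) = 0 by norm_num, show (ν : ℤ) + ((2 : ℕ) : ℤ) = ν + 2 by norm_num,
          show (ν : ℤ) - ((2 : ℕ) : ℤ) = ν - 2 by norm_num]
        exact h40 hkν

/-- **TWO FOURFOLDS, NUMERICALLY: `HC(F × F')` ⟸ `HC(F)`, `HC(F')`, `h^{2,1}(F) h^{2,1}(F') = 0`, `h^{3,0}(F) h^{3,0}(F') = 0`, `h^{3,1}(F) h^{3,1}(F') = 0`, `h^{4,0}(F) h^{4,0}(F') = 0`** — four products read off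
the two Hodge diamonds (the tree's `…tensor_fourfolds_of_hodgeNumber_mul_eq_zero` asks in addition `p_g(F) = 0 ∨ Hdg²(H⁴F') = H⁴(F';ℚ)` and its mirror). [cite: VoisinHodgeI2002, §7.1.1, §11.3.3 Thm. 11.38–11.40, Lemma 11.41, pp. 285–287]
[cite: Huybrechts2016K3, Ch. 3 Def. 2.5 and Lemma 3.1] [cite: VoisinHodgeII2003, §9.2.4 Prop. 9.20] [cite: Deligne2000, §1] -/
theorem BettiUniverse.hodgeConjectureFor_tensor_fourfolds_of_hodgeNumber_mul_eq_zero' (hHD : exists_isReal_hodgeModel) (hF : IsSmoothProjective 4 F) (hF' : IsSmoothProjective 4 F')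
    (hFF' : IsSmoothProjective d (F ⊗ F')) (hHCF : HodgeConjectureFor 4 F) (hHCF' : HodgeConjectureFor 4 F')
    (h21 : (BettiUniverse.hodge hHD hF 3).hodgeNumber 2 1 * (BettiUniverse.hodge hHD hF' 3).hodgeNumber 2 1 = 0) (h30 : (BettiUniverse.hodge hHD hF 3).hodgeNumber 3 0 * (BettiUniverse.hodge hHD hF' 3).hodgeNumber 3 0 = 0)
    (h31 : (BettiUniverse.hodge hHD hF 4).hodgeNumber 3 1 * (BettiUniverse.hodge hHD hF' 4).hodgeNumber 3 1 = 0) (h40 : (BettiUniverse.hodge hHD hF 4).hodgeNumber 4 0 * (BettiUniverse.hodge hHD hF' 4).hodgeNumber 4 0 = 0) :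
    HodgeConjectureFor d (F ⊗ F') :=
  BettiUniverse.hodgeConjectureFor_fourfold_tensor_of_forall_hodgeNumber_mul_eq_zero hHD hF hF' hFF' hHCF hHCF' (t := 1) (by norm_num) (by norm_num) (ν := 2) (by norm_num) (by norm_num)
    (by rw [show ((1 : ℕ) : ℤ) + 1 = 2 by norm_num]; exact h21) (fun _ ↦ by rw [show ((1 : ℕ) : ℤ) + 2 = 3 by norm_num, show ((1 : ℕ) : ℤ) - 1 = 0 by norm_num]; exact h30)
    (by rw [show ((2 : ℕ) : ℤ) + 1 = 3 by norm_num, show ((2 : ℕ) : ℤ) - 1 = 1 by norm_num]; exact h31)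
    fun _ ↦ by rw [show ((2 : ℕ) : ℤ) + 2 = 4 by norm_num, show ((2 : ℕ) : ℤ) - 2 = 0 by norm_num]; exact h40

end Instances

end Literature.AlgebraicGeometry.HodgeTheory

end
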